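import Mathlib
import Literature.AlgebraicGeometry.Resolution.CobordantGame
import Summits.ResolutionOfSingularities.ResolutionOfSingularities.Theorems.WeightedInvariantLocalWeightedDropGradedSliceWildProbes

/-!
# `WeightedInvariant.LocalWeightedDrop`: the wild-slice specimen has graded rank EXACTLY `1` — the rank-shift clause W-a is
# consistent with both wild specimens

Route `ResolutionOfSingularities/WeightedInvariant`, crux `LocalWeightedDrop` (stmt-ResolutionOfSingularities-8899).
[OURS · L1 W4.3] — res-type-099 (gen 13), res-type-060's kernel co-hand on the WILD SLICE CLAUSE (res-L1-w43-plan-1 DEALS gen 9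
#23), companion of `…GradedSliceWildProbes` (the specimen `g = s²(1+y_u)^10 + (y_v + y_u²)³y_z²`, `≅ W₄ = x₀² + x₃³x₁²`: slice of
graded rank `0`, successor with NO graded one-move win).  Here: the successor IS graded-won with rank `1`, so the ranks are
(slice, successor) = (0, 1) exactly — the mirror image of res-type-060's wild specimen p508918 (1, 0).  Consequently the probe
clause W-a of DEALS #11/#23 («slice graded-won with rank `α` ⇒ successor graded-won with rank `α + 1`») is CONSISTENT with both
specimens (`gradedWonBy_succ_wildSpecimen_of_slice`, `gradedWonBy_succ_umbrella_of_slice`); nothing here decides it in general.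
Nothing here is a statement of the manuscript under review on ladder RESOLUTION; not a verdict on card A.  AI proof, weaker than
expert review.

* `gradedWonBy_zero_witness4Successor` — for every lattice and `γ ≠ 0` (char `2`): `x₁² + (γ + x₄)³x₂²` is graded-won in ONE
  move (identity, centre `{x₁ = x₂ = 0}`: at an exceptional point `(d₁, d₂)` the saturation has constant term `d₁² + γ³d₂²` and
  `x₄`-coefficient `3γ²d₂²`, not both zero) — the umbrella mechanism of `gradedWonBy_zero_umbrella`.
* `gradedWonBy_one_witness4` — for every lattice (char `2`): `W₄ = x₀² + x₃³x₁²` is graded-won with rank `1` (identity, centre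
  `{x₀ = x₃ = 0}`, weights `(3, 2)`; singular successors only at `c₀ = 0 ≠ c₃`, where they are `x₁'² + (c₃ + x₄')³x₂'²`).
* `gradedWonBy_one_wildSpecimen` — `GradedWonBy 1 4 ⊤ g` (transfer along the two graded straightenings of `wildSpecimen_eq_subst`,
  `gradedWonBy_subst_of_leftInverse`).  With `not_gradedWonBy_zero_wildSpecimen`: graded rank exactly `1`.
-/

set_option linter.dupNamespace false -- mandated namespace of this single-conjunct summit
set_option autoImplicit false

namespace Summit.ResolutionOfSingularities.ResolutionOfSingularities.Theorems

namespace GradedGame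

open MvPowerSeries
open Literature.AlgebraicGeometry.Resolution
open Literature.AlgebraicGeometry.Resolution.FormalCoordChange (linMat)

variable {k : Type} [Field k]

/-! ## §1 The umbrella successors of `W₄` -/

/-- **THE SINGULAR SUCCESSORS OF `W₄` ARE GRADED-WON IN ONE MOVE** (every lattice; characteristic `2`; `γ ≠ 0`):
`GradedWonBy 0 5 L (x₁² + (γ + x₄)³·x₂²)`.  Identity move, centre `{x₁ = x₂ = 0}` (weights `(0,1,1,0,0)`); at an exceptional point
`(d₁, d₂) ≠ 0` the `s`-saturated successor `(d₁ + x₂')² + (γ + x₅')³(d₂ + x₃')²` has constant term `d₁² + γ³d₂²` and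
`x₅'`-coefficient `3γ²d₂²`: if `d₂ ≠ 0` the latter is non-zero, if `d₂ = 0` the former is `d₁² ≠ 0`. [OURS · L1 W4.3] -/
theorem gradedWonBy_zero_witness4Successor [CharP k 2] (L : AddSubgroup (Fin 5 → ℤ)) (γ : k) (hγ : γ ≠ 0) :
    GradedWonBy 0 5 L (X 1 ^ 2 + (C γ + X 4) ^ 3 * X 2 ^ 2 : MvPowerSeries (Fin 5) k) := by
  have h2 : (2 : k) = 0 := CharP.cast_eq_zero k 2
  have h3 : (3 : k) ≠ 0 := by
    have : (3 : k) = 1 := by linear_combination h2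
    rw [this]; exact one_ne_zero
  rw [gradedWonBy_zero_iff]
  refine ⟨fun i => X i, ![0, 1, 1, 0, 0], isLGradedMove_X L _ ⟨1, by simp⟩, ?_⟩
  rintro d a g' ⟨⟨i, hwi, hdi⟩, hfac, hndvd, hd0, hd1⟩
  have hC := hasSubst_cruxChart (k := k) ![0, 1, 1, 0, 0] d
  have hself : subst (fun i : Fin 5 => (X i : MvPowerSeries (Fin 5) k)) (X 1 ^ 2 + (C γ + X 4) ^ 3 * X 2 ^ 2 :
      MvPowerSeries (Fin 5) k) = (X 1 ^ 2 + (C γ + X 4) ^ 3 * X 2 ^ 2 : MvPowerSeries (Fin 5) k) := by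
    rw [show (fun i : Fin 5 => (X i : MvPowerSeries (Fin 5) k)) = X from rfl, subst_self]; rfl
  rw [hself] at hfac
  simp only [subst_add hC, subst_mul hC, subst_pow hC, subst_X hC, subst_C, cruxChart_of_pos ![0, 1, 1, 0, 0] d 1 (by simp),
    cruxChart_of_pos ![0, 1, 1, 0, 0] d 2 (by simp), cruxChart_of_eq_zero ![0, 1, 1, 0, 0] d 4 (by simp)] at hfac
  simp only [Matrix.cons_val_one, Matrix.head_cons, Matrix.cons_val_two, Matrix.tail_cons, Matrix.cons_val_zero,
    pow_one] at hfac
  have e1 : (1 : Fin 5).succ = (2 : Fin 6) := rfl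
  have e2 : (2 : Fin 5).succ = (3 : Fin 6) := rfl
  have e4 : (4 : Fin 5).succ = (5 : Fin 6) := rfl
  rw [e1, e2, e4] at hfac
  -- `hfac : (ρ(d₁ + x₂'))² + (γ + x₅')³ (ρ(d₂ + x₃'))² = ρ^a · g'`
  set G : MvPowerSeries (Fin 6) k := (C (d 1) + X 2) ^ 2 + (C γ + X 5) ^ 3 * (C (d 2) + X 3) ^ 2 with hG
  have hfac' : X 0 ^ a * g' = X 0 ^ 2 * G := by rw [← hfac, hG]; ring
  have hG0 : constantCoeff G = d 1 ^ 2 + γ ^ 3 * d 2 ^ 2 := by simp [hG, constantCoeff_X]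
  have hG5 : coeff (Finsupp.single 5 1) G = 3 * γ ^ 2 * d 2 ^ 2 := by
    rw [hG, map_add, coeff_single_one_mul_leibniz, coeff_single_one_pow_leibniz, coeff_single_one_pow_leibniz,
      coeff_single_one_pow_leibniz]
    simp [constantCoeff_X, coeff_X, coeff_C, Finsupp.single_eq_single_iff]
  -- a non-zero `ρ`-free coefficient of `G`, so `G` IS the `s`-saturated successor
  have hGnd : ¬ X 0 ∣ G := by
    rintro ⟨q, hq⟩
    by_cases hd2 : d 2 = 0
    · have hd1' : d 1 ≠ 0 := by fin_cases i <;> simp_all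
      have h := congrArg constantCoeff hq
      rw [hG0, hd2, map_mul, constantCoeff_X, zero_mul] at h
      exact pow_ne_zero 2 hd1' (by simpa using h)
    · have h := congrArg (coeff (Finsupp.single (5 : Fin 6) 1)) hq
      rw [hG5, coeff_single_X_mul, if_neg (by decide)] at h
      exact mul_ne_zero (mul_ne_zero h3 (pow_ne_zero 2 hγ)) (pow_ne_zero 2 hd2) h
  obtain ⟨-, hgG⟩ := eq_of_X_pow_mul_eq hfac' hndvd hGnd
  rw [hgG] at hd0 hd1
  have hd2 : d 2 = 0 := by
    have h := hd1 5
    rw [hG5] at h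
    rcases mul_eq_zero.mp h with h' | h'
    · rcases mul_eq_zero.mp h' with h'' | h''
      · exact absurd h'' h3
      · exact absurd (pow_eq_zero_iff two_ne_zero |>.mp h'') hγ
    · exact pow_eq_zero_iff two_ne_zero |>.mp h'
  have hd1' : d 1 = 0 := by
    rw [hG0, hd2] at hd0
    exact pow_eq_zero_iff two_ne_zero |>.mp (by simpa using hd0)
  fin_cases i <;> simp_all

/-! ## §2 `W₄` has graded rank `1` -/

/-- **`W₄ = x₀² + x₃³x₁²` IS GRADED-WON WITH RANK `1`, for every lattice** (characteristic `2`).  Identity move, centre `{x₀ = x₃ = 0}`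
with weights `(3,0,0,2)`: the `s`-saturated successor at `(c₀, c₃)` is `(c₀ + x₁')² + (c₃ + x₄')³x₂'²`; it is singular only if
`c₀ = 0` (constant term `c₀²`), hence `c₃ ≠ 0`, and then it is the umbrella of `gradedWonBy_zero_witness4Successor`, graded-won
with rank `0` in the propagated lattice. [OURS · L1 W4.3] -/
theorem gradedWonBy_one_witness4 [CharP k 2] (L : AddSubgroup (Fin 4 → ℤ)) :
    GradedWonBy 1 4 L (X 0 ^ 2 + X 3 ^ 3 * X 1 ^ 2 : MvPowerSeries (Fin 4) k) := by
  haveI : CharP (MvPowerSeries (Fin 5) k) 2 := charP_of_injective_ringHom MvPowerSeries.C_injective 2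
  rw [gradedWonBy_iff]
  refine ⟨fun i => X i, ![3, 0, 0, 2], isLGradedMove_X L _ ⟨0, by simp⟩, ?_⟩
  rintro c a g' ⟨⟨i, hwi, hci⟩, hfac, hndvd, hc0, hc1⟩
  have hC := hasSubst_cruxChart (k := k) ![3, 0, 0, 2] c
  have hself : subst (fun i : Fin 4 => (X i : MvPowerSeries (Fin 4) k)) (X 0 ^ 2 + X 3 ^ 3 * X 1 ^ 2 : MvPowerSeries (Fin 4) k) =
      (X 0 ^ 2 + X 3 ^ 3 * X 1 ^ 2 : MvPowerSeries (Fin 4) k) := by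
    rw [show (fun i : Fin 4 => (X i : MvPowerSeries (Fin 4) k)) = X from rfl, subst_self]; rfl
  rw [hself] at hfac
  simp only [subst_add hC, subst_mul hC, subst_pow hC, subst_X hC, cruxChart_of_pos ![3, 0, 0, 2] c 0 (by simp),
    cruxChart_of_eq_zero ![3, 0, 0, 2] c 1 (by simp), cruxChart_of_pos ![3, 0, 0, 2] c 3 (by simp)] at hfac
  simp only [Matrix.cons_val_zero, Matrix.cons_val_three, Matrix.tail_cons, Matrix.head_cons, Fin.succ_zero_eq_one] at hfac
  have e1 : (1 : Fin 4).succ = (2 : Fin 5) := rfl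
  have e3 : (3 : Fin 4).succ = (4 : Fin 5) := rfl
  rw [e1, e3] at hfac
  -- `hfac : (σ³(c₀ + x₁'))² + (σ²(c₃ + x₄'))³ x₂'² = σ^a · g'`
  set G : MvPowerSeries (Fin 5) k := (C (c 0) + X 1) ^ 2 + (C (c 3) + X 4) ^ 3 * X 2 ^ 2 with hG
  have hfac' : X 0 ^ a * g' = X 0 ^ 6 * G := by rw [← hfac, hG]; ring
  have hG0 : constantCoeff G = c 0 ^ 2 := by simp [hG, constantCoeff_X]
  -- the `σ`-free coefficient of `x₁'²` is `1`
  have hG12 : coeff (Finsupp.single 1 2) G = 1 := by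
    have hsq : (C (c 0) + X 1 : MvPowerSeries (Fin 5) k) ^ 2 = C (c 0 ^ 2) + X 1 ^ 2 := by rw [add_pow_char, map_pow]
    rw [hG, hsq, map_add, map_add, coeff_C, if_neg (by simp), coeff_X_pow, if_pos rfl, mul_comm, X_pow_eq, coeff_monomial_mul,
      if_neg]
    · simp
    · intro h
      have := h 2
      simp at this
  have hGnd : ¬ X 0 ∣ G := by
    rw [X_dvd_iff]
    push Not
    exact ⟨Finsupp.single 1 2, by simp, by rw [hG12]; exact one_ne_zero⟩
  obtain ⟨-, hgG⟩ := eq_of_X_pow_mul_eq hfac' hndvd hGnd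
  rw [hgG] at hc0 hc1 ⊢
  have hc00 : c 0 = 0 := by
    rw [hG0] at hc0
    exact pow_eq_zero_iff two_ne_zero |>.mp hc0
  have hc3 : c 3 ≠ 0 := by fin_cases i <;> simp_all
  refine ⟨0, zero_lt_one, ?_⟩
  rw [hG, hc00, map_zero, zero_add]
  exact gradedWonBy_zero_witness4Successor _ (c 3) hc3

/-! ## §3 The specimen has graded rank `1` -/

/-- **THE SUCCESSOR OF THE WILD-SLICE SPECIMEN IS GRADED-WON WITH RANK `1`** (lattice `⊤` = its propagated lattice,
`succLattice_wildSpecimen_eq_top`; characteristic `2`): transport `gradedWonBy_one_witness4` along the two straightenings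
`x₃ ↦ x₃ + x₂²` (graded left inverse `x₃ ↦ x₃ − x₂²`) and `x₀ ↦ x₀(1+x₂)^5` (graded left inverse `x₀ ↦ x₀·(1+x₂)^{-5}`) of
`wildSpecimen_eq_subst` (`gradedWonBy_subst_of_leftInverse`).  With `not_gradedWonBy_zero_wildSpecimen` the graded rank of the
successor is EXACTLY `1`, that of its slice exactly `0`. [OURS · L1 W4.3] -/
theorem gradedWonBy_one_wildSpecimen [CharP k 2] :
    GradedWonBy 1 4 ⊤ (X 0 ^ 2 * (1 + X 2) ^ 10 + (X 3 + X 2 ^ 2) ^ 3 * X 1 ^ 2 : MvPowerSeries (Fin 4) k) := by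
  obtain ⟨w', hw1, hw0, -⟩ := exists_inv_one_add_X (k := k) (2 : Fin 4)
  have hw5 : w' ^ 5 * (1 + X 2) ^ 5 = (1 : MvPowerSeries (Fin 4) k) := by rw [← mul_pow, hw1, one_pow]
  set ΦA := Function.update (fun i => (X i : MvPowerSeries (Fin 4) k)) 3 (X 3 + X 2 ^ 2) with hΦA
  set ΨA := Function.update (fun i => (X i : MvPowerSeries (Fin 4) k)) 3 (X 3 - X 2 ^ 2) with hΨA
  set ΦB := Function.update (fun i => (X i : MvPowerSeries (Fin 4) k)) 0 (X 0 * (1 + X 2) ^ 5) with hΦB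
  set ΨB := Function.update (fun i => (X i : MvPowerSeries (Fin 4) k)) 0 (X 0 * w' ^ 5) with hΨB
  have upd0 : ∀ (j : Fin 4) (φ : MvPowerSeries (Fin 4) k), constantCoeff φ = 0 →
      ∀ i, constantCoeff (Function.update (fun i => (X i : MvPowerSeries (Fin 4) k)) j φ i) = 0 := by
    intro j φ hφ i
    by_cases hi : i = j
    · subst hi; rw [Function.update_self]; exact hφ
    · rw [Function.update_of_ne hi]; exact constantCoeff_X i
  have hΦA0 : ∀ i, constantCoeff (ΦA i) = 0 := upd0 3 _ (by simp [constantCoeff_X])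
  have hΨA0 : ∀ i, constantCoeff (ΨA i) = 0 := upd0 3 _ (by simp [constantCoeff_X])
  have hΦB0 : ∀ i, constantCoeff (ΦB i) = 0 := upd0 0 _ (by simp [constantCoeff_X])
  have hΨB0 : ∀ i, constantCoeff (ΨB i) = 0 := upd0 0 _ (by simp [constantCoeff_X])
  have hΨAs := hasSubst_of_constantCoeff_zero hΨA0
  have hΨBs := hasSubst_of_constantCoeff_zero hΨB0
  have hΨAdet : IsUnit (linMat ΨA).det := by
    change IsUnit (Matrix.of fun i j => coeff (Finsupp.single j 1) (ΨA i)).det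
    rw [hΨA, linPart_update_X, det_updateRow_one]
    simp [coeff_X, coeff_X_pow, Finsupp.single_eq_single_iff]
  have hΨBdet : IsUnit (linMat ΨB).det := by
    change IsUnit (Matrix.of fun i j => coeff (Finsupp.single j 1) (ΨB i)).det
    rw [hΨB, linPart_update_X, det_updateRow_one, coeff_single_X_mul, if_pos rfl, map_pow, hw0, one_pow]
    exact isUnit_one
  have hgr : ∀ (Ψ : Fin 4 → MvPowerSeries (Fin 4) k) (i : Fin 4) (e : Fin 4 →₀ ℕ), coeff e (Ψ i) ≠ 0 →
      expVec e - Pi.single i 1 ∈ (⊤ : AddSubgroup (Fin 4 → ℤ)) := fun _ _ _ _ => AddSubgroup.mem_top _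
  have hinvA : ∀ j, subst ΨA (ΦA j) = X j := by
    intro j
    by_cases hj : j = 3
    · subst hj
      rw [hΦA, Function.update_self, subst_add hΨAs, subst_pow hΨAs, subst_X hΨAs, subst_X hΨAs, hΨA, Function.update_self,
        Function.update_of_ne (by decide)]
      ring
    · rw [hΦA, Function.update_of_ne hj, subst_X hΨAs, hΨA, Function.update_of_ne hj]
  have hinvB : ∀ j, subst ΨB (ΦB j) = X j := by
    intro j
    have hs1 : subst ΨB (1 : MvPowerSeries (Fin 4) k) = 1 := by rw [← coe_substAlgHom hΨBs, map_one]
    by_cases hj : j = 0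
    · subst hj
      rw [hΦB, Function.update_self, subst_mul hΨBs, subst_pow hΨBs, subst_add hΨBs, hs1, subst_X hΨBs, subst_X hΨBs, hΨB,
        Function.update_self, Function.update_of_ne (by decide)]
      linear_combination (X 0 : MvPowerSeries (Fin 4) k) * hw5
    · rw [hΦB, Function.update_of_ne hj, subst_X hΨBs, hΨB, Function.update_of_ne hj]
  have h1 := gradedWonBy_subst_of_leftInverse 1 ⊤ (X 0 ^ 2 + X 3 ^ 3 * X 1 ^ 2 : MvPowerSeries (Fin 4) k) ΦA ΨA hΦA0 hΨA0
    hΨAdet (hgr ΨA) hinvA (gradedWonBy_one_witness4 ⊤)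
  have h2 := gradedWonBy_subst_of_leftInverse 1 ⊤ _ ΦB ΨB hΦB0 hΨB0 hΨBdet (hgr ΨB) hinvB h1
  rwa [← wildSpecimen_eq_subst] at h2

/-! ## §4 W-a is consistent with both wild specimens -/

/-- W-a INSTANCE AT THE NEW SPECIMEN: the slice is graded-won with rank `0` and the successor with rank `0 + 1`. [OURS · L1 W4.3] -/
theorem gradedWonBy_succ_wildSpecimen_of_slice [CharP k 2] :
    GradedWonBy 0 3 ⊤ (sliceGerm (Fin.last 2)
        (X 0 ^ 2 * (1 + X 2) ^ 10 + (X 3 + X 2 ^ 2) ^ 3 * X 1 ^ 2 : MvPowerSeries (Fin 4) k)) ∧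
      GradedWonBy (0 + 1) 4 ⊤ (X 0 ^ 2 * (1 + X 2) ^ 10 + (X 3 + X 2 ^ 2) ^ 3 * X 1 ^ 2 : MvPowerSeries (Fin 4) k) :=
  ⟨gradedWonBy_zero_slice_wildSpecimen, by rw [zero_add]; exact gradedWonBy_one_wildSpecimen⟩

/-- W-a INSTANCE AT res-type-060's SPECIMEN p508918 (card A's umbrella, every prime `p`): the slice `Z^p + y^p` is graded-won with
rank `1` (`gradedWonBy_one_addPow`-type result `gradedWonBy_one_X_pow_add_X_pow`), the successor `Z^p + (1+x)y^p` with rank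
`1 + 1` (indeed `0`, `gradedWonBy_zero_umbrella`, and ranks are monotone). [OURS · L1 W4.3] -/
theorem gradedWonBy_succ_umbrella_of_slice (p : ℕ) [Fact p.Prime] [CharP k p] :
    GradedWonBy 1 3 (sliceLattice (succLattice (⊤ : AddSubgroup (Fin 3 → ℤ)) ![p + 1, p, p] ![(0 : k), 1, 0]) 1)
        (sliceGerm 1 (X 1 ^ p + (1 + X 2) * X 3 ^ p : MvPowerSeries (Fin 4) k)) ∧
      GradedWonBy (1 + 1) 4 (succLattice (⊤ : AddSubgroup (Fin 3 → ℤ)) ![p + 1, p, p] ![(0 : k), 1, 0])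
        (X 1 ^ p + (1 + X 2) * X 3 ^ p : MvPowerSeries (Fin 4) k) := by
  refine ⟨?_, GradedWonBy.mono (by norm_num) (gradedWonBy_zero_umbrella p _)⟩
  rw [sliceGerm_umbrella p]
  exact gradedWonBy_one_X_pow_add_X_pow p _ 1 2 (by decide)

end GradedGame

end Summit.ResolutionOfSingularities.ResolutionOfSingularities.Theorems
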